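import Mathlib
import Summits.Ventures.FusionMHD.Models.CerfonFreidbergIterLikeQHalfDefs
import HarnessLib

/-!
# Ventures/FusionMHD — Models/CerfonFreidbergIterLikeQHalfObligation.lean: the per-panel KERNEL OBLIGATION (with the
# radial-derivative range along the approximant) of the certified interior `q(ψ_N = 1/2)/F` of THE CF ITER-like instance

HONEST FRAMING (LADDER-GRIDFUSION three columns; CF rung, F2 item R2).  Definitions only (no theorem, no `decide`): `PanelCert` =
`QHalf.PanelData` (Models/CerfonFreidbergIterLikeQHalfDefs.lean) plus a claimed range `[dlo, dhi]` (× `2⁶⁰`) of the RADIAL DERIVATIVE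
register `D_r(θ, m(θ))` of `progG` (stack position 4 below the top), and `PanelCert.ok` = `PanelData.ok` ∧ that range check.  The
assembly (`…QHalf.lean`) needs `D_r` along the approximant from BELOW (it is the slope that converts the certified flux residual
`≤ 5.3·10⁻¹⁰` into the tube radius `|ρ − m| < r`).  The seven panel files `…QHalfPanels1…7.lean` decide `PanelCert.ok`; what it MEANS is
proved in `…QHalfSound.lean`.  MODELLED: analytic Cerfon–Freidberg family; nothing about a device or stability.
Typer/prover: gridfusion-model-5 (g7), 2026-08-27.  Citations: Freidberg 2014 §6.3.5 (6.35) [Freidberg2014];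
Mahboubi–Melquiond–Sibut-Pinote 2016 §3.2–§4.1 [MahboubiMelquiondSibutpinote2016].
-/

open Literature.Analysis.ValidatedNumerics Literature.Analysis.ValidatedNumerics.PolyMP
open Literature.Analysis.ValidatedNumerics.NumericsMP Literature.Analysis.ValidatedNumerics.ExpPoly

namespace Summit.Ventures.FusionMHD.Models.CFIterLike.QHalf

/-- Stack-relative position (below the top of `progG`'s final stack) of the radial-derivative register `D_r(θ, m)`. -/
def idxD : ℕ := 4

/-- **Per-panel certificate data**: `PanelData` plus the claimed range `[dlo, dhi]` (× `2⁶⁰`) of `D_r` along the approximant. -/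
structure PanelCert extends PanelData where
  /-- claimed `S·D_r(θ, m θ) ≥ dlo` on the panel -/
  dlo : ℤ
  /-- claimed `S·D_r(θ, m θ) ≤ dhi` on the panel -/
  dhi : ℤ

/-- **THE PER-PANEL KERNEL OBLIGATION** (final form): `PanelData.ok` (run accepted; integral, residual and `m` ranges inside the
claims) and the `D_r` register's range inside `[dlo, dhi]`. -/
def PanelCert.ok (d : PanelCert) : Bool :=
  let s := panelModels d.j d.cand d.deg d.elog2
  let WD := getReg [] s.1 idxD
  d.toPanelData.ok && decide (d.dlo ≤ tlowerI tmS hw WD) && decide (tupperI tmS hw WD ≤ d.dhi)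

end Summit.Ventures.FusionMHD.Models.CFIterLike.QHalf
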